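import Literature.AlgebraicGeometry.Motives.HodgeColevelFiltration
import Literature.NumberTheory.Transcendental.Sweep1
import HarnessLib

/-!
# The weight and Hodge co-level filtrations on effective formal periods (the symbol model)

The instance of `Literature.AlgebraicGeometry.Motives.HodgePeriodDatum`
(`HodgeColevelFiltration.lean`, definition request `defn-HodgeColevelFiltration` of route
`KontsevichZagierPeriods/HodgeColevel`) on the tree's space of **effective formal periods**
`P̃⁺ = FreePeriodSymbols R σ ⧸ formalPeriodRelations R B σ` of relative period data `R` with
boundary data `B` along `σ : k →+* ℂ` (`Literature.NumberTheory.Transcendental.Sweep1`; symbols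
`[(X, D, i, ω, γ)]` modulo linearity, functoriality and the boundary relation:
Huber–Müller-Stach 2017, Def. 13.1.1):

* `PairsVertex k`: the vertices `(Y, i) = Hⁱ(X, D)` of the diagram of effective pairs
  (`Y = (X, D)` a pair of varieties, `i : ℕ`; Huber–Müller-Stach draft III, §9.3.1).
* `HodgePeriodDatum.ofSymbols R B σ M`: indexed by `PairsVertex k`, with coefficient space of
  `(Y, i)` the `k`-span of the classes of the symbols `[(Y, i, ω, γ)]` and Hodge realisation
  `M Y i`, for a Hodge realisation `M : ∀ Y i, MixedHodgeStructure (V Y i)` of the vertices on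
  arbitrary carriers `V Y i` — intended: Deligne's mixed Hodge structure on `Hⁱ(X(ℂ), D(ℂ); ℚ)`
  (Hodge III, 8.3.8), i.e. the field `mhs` of the separately requested hypothesis structure
  `MixedHodgeStructureOfPair`, to be plugged in verbatim (`ofSymbols 𝒞.R 𝒞.B σ 𝓜.mhs`).
* API: the class of a symbol lies in the coefficient space of its vertex
  (`mkQ_periodSymbol_mem_coeff`); the coefficient spaces of the vertices exhaust `P̃⁺`
  (`iSup_coeff_ofSymbols`, from `exists_mem_of_forall_symbol`: an element of `P̃⁺` is a finite
  combination of symbol classes); hence every effective formal period has weight `< ⊤`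
  (`weight_ofSymbols_ne_top`, from the finiteness of weight filtrations alone) and, if every
  vertex has bounded Hodge types, Hodge co-level `< ⊤` (`hodgeColevel_ofSymbols_ne_top`); the
  symbol of a vertex with types `≤ c` (weights `≤ w`) has co-level `≤ c` (weight `≤ w`) — the step
  "`Ψ[r] ∈ C(Hᵐ(X, D)) ⊆ C_m`" of the route's `DegreeBound`.

## Design notes

* Indexed by vertices, not by all Nori motives (see the design notes of
  `HodgeColevelFiltration.lean`); the carriers `V Y i` of the Hodge realisations are left free so
  that whichever model of relative Betti cohomology the Hodge datum of pairs is stated on plugs in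
  without transport (the filtrations only see `WeightsLE` / `HodgeTypesLE` of `M Y i` and the
  coefficient spaces).
* Nothing here asserts the Hodge-theoretic properties of the intended `M` (weights of `Hⁱ(X, D)`
  in `[0, 2i]`, types in `[0, i]²`, functoriality, strictness): they are fields / facts of the
  Hodge datum of pairs, taken as hypotheses where used (`hodgeColevel_ofSymbols_ne_top`).

## References

* A. Huber, S. Müller-Stach, *Periods and Nori Motives*, Springer 2017, Def. 13.1.1; draft of
  Part III (2015), Def. 9.3.1, Def. 12.1.1.
* P. Deligne, *Théorie de Hodge III*, Publ. IHÉS 44 (1974), 8.2.4, 8.3.8–8.3.9.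
-/

noncomputable section

namespace Literature.AlgebraicGeometry.Motives

universe v

/-! ### The model: vertices `Hⁱ(X, D)` realised in the space of effective formal periods -/

section Symbols

open Literature.NumberTheory.Transcendental

variable (k : Type) [Field k] in
/-- A **vertex of the diagram of effective pairs**: a pair of `k`-varieties `Y = (X, D)` together
with a (co)homological degree `i`, standing for `Hⁱ(X, D)` (Huber–Müller-Stach draft III, §9.3.1:
"its vertices are triples `(X, D, j)` with `X` a variety, `D` a closed subvariety and `j` an
integer"). The index type of `HodgePeriodDatum.ofSymbols`. [cite: HuberMullerStachPeriodsIII2015, Def. 9.3.1] -/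
abbrev PairsVertex : Type 1 :=
  {Y : SchemePair k // Y.IsVarietyPair} × ℕ

variable {k : Type} [Field k]

/-- The vertex `Hⁱ(X, D)` of the pair of varieties `Y = (X, D)` in degree `i`. [folklore] -/
abbrev PairsVertex.mk (Y : SchemePair k) (hY : Y.IsVarietyPair) (i : ℕ) : PairsVertex k :=
  (⟨Y, hY⟩, i)

variable [CharZero k] {Pr : PeriodRealization k}
variable (R : RelativePeriodData Pr) (B : R.BoundaryData) (σ : k →+* ℂ)
variable {V : SchemePair k → ℕ → Type v} [∀ Y i, AddCommGroup (V Y i)] [∀ Y i, Module ℚ (V Y i)]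
variable (M : ∀ (Y : SchemePair k) (i : ℕ), MixedHodgeStructure (V Y i))

namespace HodgePeriodDatum

/-- **The Hodge period datum of effective formal periods.** Over relative period data `R` with
boundary data `B` and `σ : k →+* ℂ`, the space of effective formal periods is
`P̃⁺ = FreePeriodSymbols R σ ⧸ formalPeriodRelations R B σ` (symbols `[(X, D, i, ω, γ)]` modulo
linearity, functoriality and the boundary relation: Huber–Müller-Stach 2017, Def. 13.1.1, the
tree's `Literature.NumberTheory.Transcendental.formalPeriodRelations`). The datum is indexed by
the vertices `(Y, i) = Hⁱ(X, D)` (`PairsVertex k`); the coefficient space of a vertex is the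
`k`-span of the classes of its symbols `[(Y, i, ω, γ)]`, `ω ∈ Hⁱ_dR(X, D)`,
`γ ∈ Hᵢ(X_σ(ℂ), D_σ(ℂ); ℚ)` (Huber–Müller-Stach draft III, Def. 9.3.1 (2), formal version); its
Hodge realisation is `M Y i`, a mixed Hodge structure on a carrier `V Y i` supplied by the
caller — intended: Deligne's mixed Hodge structure on `Hⁱ(X(ℂ), D(ℂ); ℚ)` (Hodge III, 8.3.8),
i.e. the field `mhs` of the separately requested hypothesis structure
`MixedHodgeStructureOfPair`, plugged in verbatim. Values of `M` at pairs that are not pairs of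
varieties are never used. [cite: HuberMullerStachPeriods2017, Def. 13.1.1] -/
def ofSymbols : HodgePeriodDatum k (FreePeriodSymbols R σ ⧸ formalPeriodRelations R B σ)
    (PairsVertex k) (fun v => V v.1.1 v.2) where
  hodge v := M v.1.1 v.2
  coeff v := Submodule.span k (Set.range fun ωγ : R.obj v.1.1 v.2 × v.1.1.bettiHomology σ v.2 =>
    (formalPeriodRelations R B σ).mkQ (periodSymbol v.1.1 v.1.2 v.2 ωγ.1 ωγ.2))

variable {R B σ M}

/-- The Hodge realisation of the vertex `(Y, i)` in `ofSymbols` is `M Y i` (by `rfl`). [folklore] -/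
@[simp]
theorem hodge_ofSymbols (v : PairsVertex k) : (ofSymbols R B σ M).hodge v = M v.1.1 v.2 :=
  rfl

/-- Unfolding the coefficient space of a vertex in `ofSymbols`: the span of the classes of its
symbols. [folklore] -/
theorem coeff_ofSymbols (v : PairsVertex k) :
    (ofSymbols R B σ M).coeff v =
      Submodule.span k (Set.range fun ωγ : R.obj v.1.1 v.2 × v.1.1.bettiHomology σ v.2 =>
        (formalPeriodRelations R B σ).mkQ (periodSymbol v.1.1 v.1.2 v.2 ωγ.1 ωγ.2)) :=
  rfl

variable (M) in
/-- The class of the symbol `[(X, D, i, ω, γ)]` lies in the coefficient space of its vertex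
`Hⁱ(X, D)`. [folklore] -/
theorem mkQ_periodSymbol_mem_coeff (Y : SchemePair k) (hY : Y.IsVarietyPair) (i : ℕ)
    (ω : R.obj Y i) (γ : Y.bettiHomology σ i) :
    (formalPeriodRelations R B σ).mkQ (periodSymbol Y hY i ω γ) ∈
      (ofSymbols R B σ M).coeff (PairsVertex.mk Y hY i) :=
  Submodule.subset_span ⟨(ω, γ), rfl⟩

/-- Finite exhaustion by steps of a monotone filtration: if every class of a symbol lies in some
step of a monotone `ℤ`-family `S` of submodules of `P̃⁺`, then so does every effective formal
period (an element of `P̃⁺` is a finite `k`-combination of classes of symbols). [folklore] -/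
theorem exists_mem_of_forall_symbol
    {S : ℤ → Submodule k (FreePeriodSymbols R σ ⧸ formalPeriodRelations R B σ)} (hS : Monotone S)
    (h : ∀ s : PeriodSymbol R σ, ∃ n, (formalPeriodRelations R B σ).mkQ (PeriodSymbol.of s) ∈ S n)
    (x : FreePeriodSymbols R σ ⧸ formalPeriodRelations R B σ) : ∃ n, x ∈ S n := by
  obtain ⟨y, rfl⟩ := Submodule.mkQ_surjective (formalPeriodRelations R B σ) x
  induction y using Finsupp.induction with
  | zero => exact ⟨0, by simp⟩
  | single_add s c f _ _ ih =>
    obtain ⟨n₁, hn₁⟩ := h s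
    obtain ⟨n₂, hn₂⟩ := ih
    refine ⟨max n₁ n₂, ?_⟩
    rw [map_add]
    refine Submodule.add_mem _ ?_ (hS (le_max_right _ _) hn₂)
    rw [← Finsupp.smul_single_one, map_smul]
    exact Submodule.smul_mem _ c (hS (le_max_left _ _) hn₁)

/-- **The coefficient spaces of the vertices exhaust `P̃⁺`**: every effective formal period is a
finite `k`-combination of classes of symbols (Huber–Müller-Stach 2017, Def. 13.1.1: `P̃⁺` is
generated by the symbols). [cite: HuberMullerStachPeriods2017, Def. 13.1.1] -/
theorem iSup_coeff_ofSymbols : ⨆ v, (ofSymbols R B σ M).coeff v = ⊤ := by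
  refine Submodule.eq_top_iff'.2 fun x => ?_
  -- the constant family `n ↦ ⨆ v, coeff v` is monotone and contains every symbol class
  obtain ⟨-, h⟩ := exists_mem_of_forall_symbol (S := fun _ : ℤ => ⨆ v, (ofSymbols R B σ M).coeff v)
    (fun _ _ _ => le_rfl) (fun s => ⟨0, Submodule.mem_iSup_of_mem
      (PairsVertex.mk s.Y s.isVarietyPair s.i)
      (mkQ_periodSymbol_mem_coeff M s.Y s.isVarietyPair s.i s.ω s.γ)⟩) x
  exact h

/-- **Every effective formal period has weight `< ⊤`**: each vertex has bounded weights (its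
weight filtration is exhaustive), and an element of `P̃⁺` involves finitely many vertices. [folklore] -/
theorem weight_ofSymbols_ne_top (x : FreePeriodSymbols R σ ⧸ formalPeriodRelations R B σ) :
    (ofSymbols R B σ M).weight x ≠ ⊤ := by
  have h : ∀ s : PeriodSymbol R σ, ∃ w,
      (formalPeriodRelations R B σ).mkQ (PeriodSymbol.of s) ∈ (ofSymbols R B σ M).weightFiltration w :=
    fun s => (M s.Y s.i).exists_weightsLE.imp fun w hw =>
      (ofSymbols R B σ M).coeff_le_weightFiltration (i := PairsVertex.mk s.Y s.isVarietyPair s.i) hw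
        (mkQ_periodSymbol_mem_coeff M s.Y s.isVarietyPair s.i s.ω s.γ)
  obtain ⟨w, hw⟩ :=
    exists_mem_of_forall_symbol (ofSymbols R B σ M).monotone_weightFiltration h x
  exact fun hx => weight_eq_top_iff.1 hx w hw

/-- **Every effective formal period has Hodge co-level `< ⊤`** as soon as every vertex `Hⁱ(X, D)`
has bounded Hodge types (for the intended `M`: types in `[0, i]²`, Deligne, Hodge III, 8.2.4 and
8.3.9 — a property of `M`, taken as the hypothesis `hM`). [folklore] -/
theorem hodgeColevel_ofSymbols_ne_top
    (hM : ∀ Y : SchemePair k, Y.IsVarietyPair → ∀ i : ℕ, ∃ c, (M Y i).HodgeTypesLE c)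
    (x : FreePeriodSymbols R σ ⧸ formalPeriodRelations R B σ) :
    (ofSymbols R B σ M).hodgeColevel x ≠ ⊤ := by
  have h : ∀ s : PeriodSymbol R σ, ∃ c, (formalPeriodRelations R B σ).mkQ (PeriodSymbol.of s) ∈
      (ofSymbols R B σ M).hodgeColevelFiltration c :=
    fun s => (hM s.Y s.isVarietyPair s.i).imp fun c hc =>
      (ofSymbols R B σ M).coeff_le_hodgeColevelFiltration
        (i := PairsVertex.mk s.Y s.isVarietyPair s.i) hc
        (mkQ_periodSymbol_mem_coeff M s.Y s.isVarietyPair s.i s.ω s.γ)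
  obtain ⟨c, hc⟩ :=
    exists_mem_of_forall_symbol (ofSymbols R B σ M).monotone_hodgeColevelFiltration h x
  exact fun hx => hodgeColevel_eq_top_iff.1 hx c hc

/-- The symbol `[(X, D, i, ω, γ)]` of a vertex with Hodge types `≤ c` has co-level `≤ c` — the
step "`Ψ[r] ∈ C(Hᵐ(X, D)) ⊆ C_m`" of route `HodgeColevel`'s `DegreeBound`, given the type bound
of the vertex. [folklore] -/
theorem hodgeColevel_mkQ_periodSymbol_le {Y : SchemePair k} (hY : Y.IsVarietyPair) {i : ℕ}
    {c : ℤ} (hc : (M Y i).HodgeTypesLE c) (ω : R.obj Y i) (γ : Y.bettiHomology σ i) :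
    (ofSymbols R B σ M).hodgeColevel ((formalPeriodRelations R B σ).mkQ (periodSymbol Y hY i ω γ)) ≤
      (c : WithTop ℤ) :=
  (ofSymbols R B σ M).hodgeColevel_le_of_mem_coeff (i := PairsVertex.mk Y hY i) hc
    (mkQ_periodSymbol_mem_coeff M Y hY i ω γ)

/-- The symbol `[(X, D, i, ω, γ)]` of a vertex with weights `≤ w` has weight `≤ w`. [folklore] -/
theorem weight_mkQ_periodSymbol_le {Y : SchemePair k} (hY : Y.IsVarietyPair) {i : ℕ} {w : ℤ}
    (hw : (M Y i).WeightsLE w) (ω : R.obj Y i) (γ : Y.bettiHomology σ i) :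
    (ofSymbols R B σ M).weight ((formalPeriodRelations R B σ).mkQ (periodSymbol Y hY i ω γ)) ≤
      (w : WithTop ℤ) :=
  (ofSymbols R B σ M).weight_le_of_mem_coeff (i := PairsVertex.mk Y hY i) hw
    (mkQ_periodSymbol_mem_coeff M Y hY i ω γ)

end HodgePeriodDatum

end Symbols

end Literature.AlgebraicGeometry.Motives

end
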